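import Summits.ValiantsHypothesis.ValiantsHypothesis.Theorems.SuccinctLiftSmlAnyField
import Literature.Computability.AlgebraicComplexity.AndrewsForbes2022BorderLST
import HarnessLib

/-!
# Route `VPBoundarySquare` — BORDER = EXACT on the rank-method window, slope `σ < 1/2`, over EVERY field

Decomp-valiant workshop, lens 3 «border-complexity / debordering axis», generation 31; offer O6, STAGE 1
(called by the workshop critic).  Unconditional, 0 sorry, no named fact, no new currency (the tree's
`borderClass` / `productDepthEdgeClass` of `AndrewsForbes2022Applications.lean`).  CALIBRATION of the
lens-3 record: it does NOT prove `VP ≠ VNP`, moves no tag, closes no crux, names no new open cell — the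
open end of the depth dial (relative depth `σ ∈ (18/25, 1]`) is the same for border and for exact
computation and is lens 4's budget.

WHAT IS PROVED (all kernel).  Write `L₃ m = ⌊log₂⌊log₂⌊log₂ m⌋⌋⌋`, `d(m) = ⌊√⌊log₂ m⌋⌋`, `F((ε)) =
LaurentSeries F`; a BORDER circuit for `f ∈ F[X]` is a circuit over `F((ε))` computing `f + O(ε)`
coefficientwise (`PolyOrdGE 1`, Andrews–Forbes 2022 Def. 2.1 = the tree's `borderClass`).

* `homLst_geom_border`, `homLst_geom_solved_border` — the border twins of lens 4's homogeneous
  Limaye–Srinivasan–Tavenas engine `DepthWindow.homLst_geom(_solved)`: over any field `F`, a circuit over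
  `F((ε))` of product depth `≤ Δ` all of whose gate values are homogeneous, computing `IMM_{n,d} + O(ε)`,
  with `1 ≤ λ`, `λ^{2^Δ-1} 2^{2^Δ} ≤ d`, `10 d ≤ ⌊log₂ n⌋ = k`, has `2^{-k/2} ≤ (s d^d + 1)^Δ 2^{-kλ/20}`.
  MECHANISM («rank methods are blind to `O(ε)`», inserted once): the engine's measure-level lemma
  `DepthWindow.relRank_eval_le_geom` (file `DepthWindowHomFlatRank.lean`) is CALLED as it stands, over the
  field `F((ε))`; only the one step of `homLst_geom` that used exact computation (`heval`:
  `ρ(C.eval) = P_w`) is replaced by Andrews–Forbes 2022 Lemma 6.2 = the tree's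
  `BorderLST.relRank_le_of_polyOrdGE` (`relrk_F(P_w) ≤ relrk_{F((ε))}(P_w + O(ε))`), the word substitution
  having coefficients `0, 1` (`LSTWord.map_wordSubst`, `map_wordPoly`).  No fork of the engine: its
  12-line greedy-word preamble and the real arithmetic of `homLst_geom_solved` / `homImmHard_coreK` /
  `immHard_anyField` (which consume only the final inequality) are re-run verbatim with `Computes`
  replaced by `+ O(ε)`.
* `homImmHard_coreK_border` — the border twin of `SuccinctLiftSmlAnyField.homImmHard_coreK` (the kernel of
  `Hard(σ)`, `σ < 1`, for homogeneous border circuits over any field).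
* ★ `immBorderHard_anyField` — the border twin of lens 2's `SuccinctLiftSmlAnyField.immHard_anyField`
  (Forbes CCC 2024 in the kernel): **for every field `F`, every slope `p/q < 1/2` and every `c`, for all
  large `m`, `IMM_{m,d(m)} ∉ borderClass F (productDepthEdgeClass F((ε)) _ (m^c + c) (⌊p·L₃ m/q⌋ + c))`** —
  every border circuit (unbounded fan-in, arbitrary constants of `F((ε))`, no homogeneity assumption) for
  `IMM_{m,d(m)}` of product depth `≤ ⌊p·L₃ m/q⌋ + c` has more than `m^c + c` wires
  (`immBorderHard_anyField_circuit`, the same in circuit language).  Forbes' low-depth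
  set-multilinearisation `SuccinctLiftSmlCircuit.exists_sml_circuit` is run over the field `F((ε))`; the
  set-multilinear projection is coefficientwise (`coeff_smlProj`), so it keeps `O(ε)` terms `O(ε)`
  (`polyOrdGE_smlProj`) and fixes `IMM` (`isSetMultilinear_immPoly` over `F((ε))`, `map_immPoly`).

Print status / placement: the border LST bound is Andrews–Forbes 2022, Lemma 6.2 / Cor. 6.5 / Lemma 6.6
(for `IMM` and `det`, `char F = 0` or `> d`, constant `δ(Δ)`; tree: `AndrewsForbes2022_cor_6_5_engine(_mu)`,
whose reach at growing depth is relative depth `< 1/log₂ 7 ≈ 0.356` only, `μ_Δ ≥ 7^{-Δ}`); the any-field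
exact bound is Forbes, CCC 2024, Thm. 1 (tree: `immHard_anyField`); the growing-depth window is
Bhargav–Dutta–Saxena, ToCT 2024, Thm. 1.4 / Lemma 7.  «border × any field × growing depth `σ < 1/2`» =
the same proofs composed — folklore-grade, not located in print.  The constant-depth border bound for
`per` over `ℂ` of the record is V27 (`DecompCycle1CPerBorderConstDepth.lean`) / V28
(`VPBoundarySquareBorderDepthConst.lean`); this file is its growing-depth, any-field `IMM` form on
`σ < 1/2` (stage 2, not here: the Bhargav–Dutta–Saxena slope `25p ≤ 18q`, the `det`/`per` transports and
the `ℂ`-Zariski reading through `borderDepthClass_eq_borderClass`).  Rung 0 of the Valiant ladder;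
nothing here bears on `VP ≠ VNP`.

References: [AndrewsForbes2022] Def. 2.1, Lemma 6.2, Cor. 6.5, Lemma 6.6 (arXiv:2112.00792, pp. 32–33);
[Forbes2024LowDepth] Thm. 1, §1.2; [LimayeSrinivasanTavenas2025] Lemma 8, Lemma 12, Cor. 4, Claim 16;
[BhargavDuttaSaxena2024] Thm. 1.4, Lemma 7.
-/

-- layout Summits/ValiantsHypothesis/ValiantsHypothesis forces the duplicated namespace component
set_option linter.dupNamespace false

namespace Summit.ValiantsHypothesis.ValiantsHypothesis.Theorems.VPBoundarySquare

open MvPolynomial Real Literature.Computability.AlgebraicComplexity ArithCircuit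
open Literature.Computability.AlgebraicComplexity.LSTWord
open Literature.Computability.AlgebraicComplexity.BorderLST
open Literature.Computability.Complexity
open Summit.ValiantsHypothesis.ValiantsHypothesis.Theorems.DepthWindow
open Summit.ValiantsHypothesis.ValiantsHypothesis.Theorems.SuccinctLiftSmlCircuit
open Summit.ValiantsHypothesis.ValiantsHypothesis.Theorems.SuccinctLiftSmlAnyField

noncomputable section

universe u v w

/-! ### `O(ε)` bookkeeping: base change of `IMM`, set-multilinear projection -/

/-- `IMM_{n,d} = tr(X⁽⁰⁾⋯X⁽ᵈ⁻¹⁾)` has coefficients `0, 1`: it commutes with any change of scalars.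
[cite: LimayeSrinivasanTavenas2025, Lemma 8] -/
theorem map_immPoly {K L : Type*} [CommSemiring K] [CommSemiring L] (φ : K →+* L) (n d : ℕ) :
    MvPolynomial.map φ (immPoly n d K) = immPoly n d L := by
  unfold immPoly Matrix.trace
  rw [map_sum]
  refine Finset.sum_congr rfl fun i _ => ?_
  simpa only [Matrix.diag_apply] using map_immMatrix_apply φ d i i

/-- The set-multilinear projection is coefficientwise (it keeps or drops monomials), so it maps
polynomials with `O(ε^k)` coefficients to polynomials with `O(ε^k)` coefficients.
[cite: AndrewsForbes2022, Lemma 6.2] [cite: LimayeSrinivasanTavenas2025, Lemma 12] -/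
theorem polyOrdGE_smlProj {F : Type u} [Field F] {σ : Type v} {ι : Type w} [DecidableEq ι]
    (blk : σ → ι) (S : Finset ι) {k : ℤ} {p : MvPolynomial σ (LaurentSeries F)}
    (hp : PolyOrdGE k p) : PolyOrdGE k (smlProj blk S p) := by
  intro e
  rw [coeff_smlProj]
  split_ifs
  · exact hp e
  · exact IsOrdGE.zero k

/-! ### The homogeneous engine on BORDER circuits (lens 4's `homLst_geom`, `+ O(ε)`) -/

/-- **LST for homogeneous BORDER circuits, explicit geometric form**: over any field `F`, a circuit
over `F((ε))` of product-depth `≤ Δ` all of whose gate values are homogeneous, computing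
`IMM_{n,d} + O(ε)`, with `1 ≤ λ`, `λ^{2^Δ-1} 2^{2^Δ} ≤ d` and `10 d ≤ ⌊log₂ n⌋ = k`, satisfies
`2^{-k/2} ≤ (s d^d + 1)^Δ 2^{-kλ/20}`.  Proof = `DepthWindow.homLst_geom` with the engine
`relRank_eval_le_geom` run over the field `F((ε))` and the exact step `ρ(C.eval) = P_w` replaced by
`relrk_F(P_w) ≤ relrk_{F((ε))}(ρ(C.eval))` (Andrews–Forbes Lemma 6.2, `relRank_le_of_polyOrdGE`;
`ρ = wordSubst` has coefficients in `F`).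
[cite: AndrewsForbes2022, Lemma 6.2] [cite: LimayeSrinivasanTavenas2025, Cor. 4] -/
theorem homLst_geom_border (F : Type u) [Field F] {Δ : ℕ} (n d : ℕ) (hd1 : 1 ≤ d) {lam : ℝ}
    (hlam : 1 ≤ lam) (hfit : lam ^ (2 ^ Δ - 1) * 2 ^ (2 ^ Δ) ≤ (d : ℝ)) (hdn : 10 * d ≤ Nat.log 2 n)
    (C : ArithCircuit (LaurentSeries F) (Fin d × Fin n × Fin n)) (hCΔ : C.productDepth ≤ Δ)
    (hhom : ∀ v ∈ ArithCircuit.gateValues C.gates, ∃ e : ℕ, v.IsHomogeneous e)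
    (hC : PolyOrdGE 1 (C.eval - MvPolynomial.map (algebraMap F (LaurentSeries F)) (immPoly n d F))) :
    (2 : ℝ) ^ (-(Nat.log 2 n : ℝ) / 2) ≤
      ((C.size * d ^ d + 1 : ℕ) : ℝ) ^ Δ * (2 : ℝ) ^ (-(Nat.log 2 n : ℝ) * lam / 20) := by
  set k := Nat.log 2 n with hk
  have hk1 : 1 ≤ k := le_trans (by omega) hdn
  have hn0 : n ≠ 0 := by
    rintro rfl
    rw [Nat.log_zero_right] at hk
    omega
  have h2k : 2 ^ k ≤ n := Nat.pow_log_le_self 2 hn0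
  -- the greedy `k`-unbiased word and the word substitution, over the field `F((ε))`
  set pos := greedyWord d k with hpos
  have hover : ∀ t, t ≤ d → overLen k pos t ≤ k := by
    intro t ht
    rw [overLen_eq_natAbs k pos t ht]
    have h := abs_prefixSum_greedyWord_le d k t ht
    rw [← hpos, abs_le] at h
    omega
  have hn' : ∀ t, t ≤ d → 2 ^ overLen k pos t ≤ n := fun t ht =>
    (Nat.pow_le_pow_right Nat.two_pos (hover t ht)).trans h2k
  have hg := isBlockPreserving_wordSubst k pos (LaurentSeries F) hn'
  have hrig := rigid_of_gateValues (k := k) (pos := pos) hg hhom Δ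
  -- the measure bound of the engine, over `F((ε))` (lens 4, called as it stands)
  have hup := relRank_eval_le_geom (P := C) hg hlam hdn hd1 hCΔ hfit hrig
  -- `ρ(IMM) = P_w` after base change: the substitution has coefficients in `F`
  have hIMM : aeval (wordSubst k pos (LaurentSeries F) hn')
      (MvPolynomial.map (algebraMap F (LaurentSeries F)) (immPoly n d F)) =
      MvPolynomial.map (algebraMap F (LaurentSeries F)) (wordPoly k pos F) := by
    rw [map_immPoly, aeval_wordSubst_immPoly k pos (LaurentSeries F) hn' hd1, map_wordPoly]
  -- `ρ(C.eval) = P_w + O(ε)`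
  have hE : PolyOrdGE 1 (aeval (wordSubst k pos (LaurentSeries F) hn') C.eval -
      MvPolynomial.map (algebraMap F (LaurentSeries F)) (wordPoly k pos F)) := by
    rw [← hIMM, ← map_sub, MvPolynomial.aeval_eq_bind₁]
    refine hC.bind₁ fun v => ?_
    rw [← map_wordSubst k pos F hn' (algebraMap F (LaurentSeries F)) v]
    exact PolyOrdGE.map_algebraMap _
  -- lower bound over `F` (full rank of `P_w`), transported to `F((ε))` by Lemma 6.2; upper bound over `F((ε))`
  have hlow := relRank_wordPoly_ge k pos F (hover d le_rfl)
  have hmid := relRank_le_of_polyOrdGE pos Finset.univ (wordPoly k pos F) _ hE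
  exact (hlow.trans hmid).trans hup

/-- **Solved for the size** (border twin of `DepthWindow.homLst_geom_solved`): under the hypotheses of
`homLst_geom_border` and `Δ ≥ 1`, `2^{k (λ - 10)/(20 Δ)} ≤ s d^d + 1` (`k = ⌊log₂ n⌋`).
[cite: AndrewsForbes2022, Lemma 6.2] [cite: LimayeSrinivasanTavenas2025, Cor. 4] -/
theorem homLst_geom_solved_border (F : Type u) [Field F] {Δ : ℕ} (hΔ : 1 ≤ Δ) (n d : ℕ) (hd1 : 1 ≤ d)
    {lam : ℝ} (hlam : 1 ≤ lam) (hfit : lam ^ (2 ^ Δ - 1) * 2 ^ (2 ^ Δ) ≤ (d : ℝ))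
    (hdn : 10 * d ≤ Nat.log 2 n) (C : ArithCircuit (LaurentSeries F) (Fin d × Fin n × Fin n))
    (hCΔ : C.productDepth ≤ Δ) (hhom : ∀ v ∈ ArithCircuit.gateValues C.gates, ∃ e : ℕ, v.IsHomogeneous e)
    (hC : PolyOrdGE 1 (C.eval - MvPolynomial.map (algebraMap F (LaurentSeries F)) (immPoly n d F))) :
    (2 : ℝ) ^ ((Nat.log 2 n : ℝ) * (lam - 10) / (20 * Δ)) ≤ ((C.size * d ^ d + 1 : ℕ) : ℝ) := by
  have h := homLst_geom_border F n d hd1 hlam hfit hdn C hCΔ hhom hC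
  set k := Nat.log 2 n
  set X : ℝ := ((C.size * d ^ d + 1 : ℕ) : ℝ) with hX
  have hX0 : 0 ≤ X := Nat.cast_nonneg _
  have h2 : (0 : ℝ) < 2 := by norm_num
  -- multiply by `2^{kλ/20}`
  have h1 : (2 : ℝ) ^ ((k : ℝ) * (lam - 10) / 20) ≤ X ^ Δ := by
    have hmul := mul_le_mul_of_nonneg_right h (Real.rpow_nonneg h2.le ((k : ℝ) * lam / 20))
    rw [mul_assoc, ← Real.rpow_add h2, ← Real.rpow_add h2] at hmul
    have e1 : -(k : ℝ) / 2 + (k : ℝ) * lam / 20 = (k : ℝ) * (lam - 10) / 20 := by ring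
    have e2 : -(k : ℝ) * lam / 20 + (k : ℝ) * lam / 20 = 0 := by ring
    rw [e1, e2, Real.rpow_zero, mul_one] at hmul
    exact hmul
  -- take the `Δ`-th root
  have hΔ0 : (Δ : ℝ) ≠ 0 := by positivity
  have h3 : ((2 : ℝ) ^ ((k : ℝ) * (lam - 10) / 20)) ^ ((Δ : ℝ)⁻¹) ≤ (X ^ Δ) ^ ((Δ : ℝ)⁻¹) :=
    Real.rpow_le_rpow (by positivity) h1 (by positivity)
  rw [Real.pow_rpow_inv_natCast hX0 (by omega), ← Real.rpow_mul h2.le] at h3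
  have e3 : (k : ℝ) * (lam - 10) / 20 * (Δ : ℝ)⁻¹ = (k : ℝ) * (lam - 10) / (20 * Δ) := by
    field_simp
  rwa [e3] at h3

/-! ### The kernel of `Hard(σ)`, `σ < 1`, for homogeneous BORDER circuits over any field -/

/-- **Border twin of `SuccinctLiftSmlAnyField.homImmHard_coreK`**: with `L = ⌊log₂ m⌋`, `d = ⌊√L⌋`, a
circuit over `F((ε))` for `IMM_{m,d} + O(ε)` all of whose gate values are homogeneous and of product
depth `≤ ⌊p ⌊log₂⌊log₂ L⌋⌋/q⌋ + c` (`p < q`) has `> m^c + c` gates, for `m ≥ 2^{max L₀ 100}`.  Same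
arithmetic, verbatim, on `homLst_geom_solved_border`.
[cite: AndrewsForbes2022, Cor. 6.5] [cite: LimayeSrinivasanTavenas2025, Cor. 4]
[cite: BhargavDuttaSaxena2024, Lemma 7] -/
theorem homImmHard_coreK_border (F : Type u) [Field F] (p q c : ℕ) (hpq : p < q) {L₀ : ℕ}
    (hL₀ : ∀ L : ℕ, L₀ ≤ L → (140 * (c + 1) * (p * Nat.log 2 (Nat.log 2 L) / q + c + 1)) ^
      2 ^ (p * Nat.log 2 (Nat.log 2 L) / q + c + 1 + 1) ≤ L)
    (m : ℕ) (hm : 2 ^ max L₀ 100 ≤ m) {d L : ℕ} (hL : L = Nat.log 2 m) (hd : d = Nat.sqrt L)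
    (D : ArithCircuit (LaurentSeries F) (Fin d × Fin m × Fin m))
    (hhom : ∀ v ∈ ArithCircuit.gateValues D.gates, ∃ e : ℕ, v.IsHomogeneous e)
    (hD : PolyOrdGE 1 (D.eval - MvPolynomial.map (algebraMap F (LaurentSeries F)) (immPoly m d F)))
    (hpd : D.productDepth ≤ p * Nat.log 2 (Nat.log 2 L) / q + c) :
    m ^ c + c < D.size := by
  have hq : 0 < q := by omega
  have hLge : max L₀ 100 ≤ L := by rw [hL]; exact Nat.le_log_of_pow_le (by norm_num) hm
  have hL0 : L₀ ≤ L := le_trans (le_max_left _ _) hLge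
  have hL100 : 100 ≤ L := le_trans (le_max_right _ _) hLge
  have hd10 : 10 ≤ d := by rw [hd]; exact Nat.le_sqrt.2 (by omega)
  have hdd : d * d ≤ L := by rw [hd]; exact Nat.sqrt_le L
  have hdn : 10 * d ≤ L := le_trans (Nat.mul_le_mul_right d hd10) hdd
  have hdnm : 10 * d ≤ Nat.log 2 m := hL ▸ hdn
  have hd1 : 1 ≤ d := by omega
  set Δ' := p * Nat.log 2 (Nat.log 2 L) / q + c + 1 with hΔ'
  have hpd' : D.productDepth ≤ Δ' := by omega
  have hΔ1 : 1 ≤ Δ' := by omega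
  -- the fit, in `ℕ` and then in `ℝ`
  have hfitN : (140 * (c + 1) * Δ') ^ 2 ^ (Δ' + 1) ≤ L := hL₀ L hL0
  have hAd : (140 * (c + 1) * Δ') ^ 2 ^ Δ' ≤ d := by
    rw [hd, Nat.le_sqrt', ← pow_mul, ← pow_succ]
    exact hfitN
  have hx : 1 ≤ 70 * (c + 1) * Δ' := by nlinarith
  have hfit : ((70 * (c + 1) * Δ' : ℕ) : ℝ) ^ (2 ^ Δ' - 1) * 2 ^ (2 ^ Δ') ≤ (d : ℝ) := by
    have h1 : (70 * (c + 1) * Δ') ^ (2 ^ Δ' - 1) * 2 ^ (2 ^ Δ') ≤ (140 * (c + 1) * Δ') ^ 2 ^ Δ' := by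
      calc (70 * (c + 1) * Δ') ^ (2 ^ Δ' - 1) * 2 ^ (2 ^ Δ')
          ≤ (70 * (c + 1) * Δ') ^ (2 ^ Δ') * 2 ^ (2 ^ Δ') :=
            Nat.mul_le_mul_right _ (Nat.pow_le_pow_right hx (Nat.sub_le _ _))
        _ = (140 * (c + 1) * Δ') ^ 2 ^ Δ' := by rw [← mul_pow]; congr 1; ring
    exact_mod_cast h1.trans hAd
  have hlam : (1 : ℝ) ≤ ((70 * (c + 1) * Δ' : ℕ) : ℝ) := by exact_mod_cast hx
  have h := homLst_geom_solved_border F hΔ1 m d hd1 hlam hfit hdnm D hpd' hhom hD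
  rw [← hL] at h
  -- the exponent is at least `3 (c+1) L`
  have hexp : (((3 * (c + 1) * L : ℕ) : ℝ)) ≤
      (L : ℝ) * ((((70 * (c + 1) * Δ' : ℕ) : ℝ)) - 10) / (20 * (Δ' : ℝ)) := by
    have hΔR : (1 : ℝ) ≤ Δ' := by exact_mod_cast hΔ1
    have hLR : (0 : ℝ) ≤ L := Nat.cast_nonneg _
    have hcR : (0 : ℝ) ≤ c := Nat.cast_nonneg _
    have hkey : (0 : ℝ) ≤ (L : ℝ) * (((c : ℝ) + 1) * Δ' - 1) := mul_nonneg hLR (by nlinarith)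
    rw [le_div_iff₀ (by positivity)]
    push_cast
    nlinarith [hkey]
  have hN : 2 ^ (3 * (c + 1) * L) ≤ D.size * d ^ d + 1 := by
    have h1 := (Real.rpow_le_rpow_of_exponent_le one_le_two hexp).trans h
    rw [Real.rpow_natCast] at h1
    exact_mod_cast h1
  -- suppose the circuit were small
  by_contra hs
  push Not at hs
  have hm2 : m < 2 ^ (L + 1) := by rw [hL]; exact Nat.lt_pow_succ_log_self one_lt_two m
  have hmc : m ^ c ≤ 2 ^ ((L + 1) * c) := by
    rw [pow_mul]; exact Nat.pow_le_pow_left hm2.le c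
  have hmcc : m ^ c + c ≤ 2 ^ ((L + 1) * c + c) := by
    have h1 : c + 1 ≤ 2 ^ c := Nat.lt_two_pow_self
    have h2 : 1 ≤ 2 ^ ((L + 1) * c) := Nat.one_le_two_pow
    calc m ^ c + c ≤ 2 ^ ((L + 1) * c) + 2 ^ ((L + 1) * c) * c := by nlinarith
      _ = 2 ^ ((L + 1) * c) * (c + 1) := by ring
      _ ≤ 2 ^ ((L + 1) * c) * 2 ^ c := Nat.mul_le_mul_left _ h1
      _ = 2 ^ ((L + 1) * c + c) := by rw [← pow_add]
  have hddL : d ^ d ≤ 2 ^ L := by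
    calc d ^ d ≤ (2 ^ d) ^ d := Nat.pow_le_pow_left (Nat.lt_two_pow_self).le d
      _ = 2 ^ (d * d) := by rw [← pow_mul]
      _ ≤ 2 ^ L := Nat.pow_le_pow_right (by norm_num) hdd
  have hup : D.size * d ^ d + 1 ≤ 2 ^ ((L + 1) * c + c + L + 1) := by
    have h1 : D.size * d ^ d ≤ 2 ^ ((L + 1) * c + c + L) := by
      rw [pow_add]; exact Nat.mul_le_mul (hs.trans hmcc) hddL
    have h2 : 1 ≤ 2 ^ ((L + 1) * c + c + L) := Nat.one_le_two_pow
    rw [pow_succ]; omega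
  have hfin := (Nat.pow_le_pow_iff_right (by norm_num)).1 (hN.trans hup)
  have hcL : c ≤ c * L := Nat.le_mul_of_pos_right c (by omega)
  nlinarith [hcL]

/-! ### ★ The theorem: border LST over any field, general circuits, relative depth `σ < 1/2` -/

/-- ★ **Limaye–Srinivasan–Tavenas for BORDER circuits over ANY field, general circuits** (the border
twin of `SuccinctLiftSmlAnyField.immHard_anyField`; Andrews–Forbes 2022 §6.1 × Forbes CCC 2024 ×
Bhargav–Dutta–Saxena's growing depth, composed in the kernel): for every field `F`, every slope
`p/q < 1/2` and every `c`, for all large `m`, `IMM_{m,⌊√⌊log₂ m⌋⌋}` is NOT in the border of the class of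
circuits over `F((ε))` with at most `m^c + c` wires and product depth
`≤ ⌊p·⌊log₂⌊log₂⌊log₂ m⌋⌋⌋/q⌋ + c` — in the tree's currency `borderClass F (productDepthEdgeClass F((ε)) …)`
(Andrews–Forbes Def. 2.1: computing `IMM + O(ε)`; unbounded fan-in, arbitrary constants, NO homogeneity
assumption).  Proof: prune empty gates, set-multilinearise at low depth over the field `F((ε))`
(`exists_sml_circuit`: depth `× 2`, size `× γ(d) ≤ m²`, all gate values homogeneous; the projection keeps
`O(ε)` terms `O(ε)` and fixes `IMM`), and apply `homImmHard_coreK_border` at slope `2p/q < 1` and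
exponent `2c + 3`.  BORDER = EXACT on this window: the statement and the threshold are those of
`immHard_anyField`. [cite: AndrewsForbes2022, Lemma 6.2, Cor. 6.5] [cite: Forbes2024LowDepth, Thm. 1, §1.2]
[cite: LimayeSrinivasanTavenas2025, Lemma 12, Cor. 4] [cite: BhargavDuttaSaxena2024, Thm. 1.4] -/
theorem immBorderHard_anyField (F : Type u) [Field F] {p q : ℕ} (hpq : 2 * p < q) (c : ℕ) :
    ∃ m₁ : ℕ, ∀ m : ℕ, m₁ ≤ m →
      immPoly m (Nat.sqrt (Nat.log 2 m)) F ∉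
        borderClass F (productDepthEdgeClass (LaurentSeries F)
          (Fin (Nat.sqrt (Nat.log 2 m)) × Fin m × Fin m) (m ^ c + c)
          (p * Nat.log 2 (Nat.log 2 (Nat.log 2 m)) / q + c)) := by
  obtain ⟨L₀, hL₀⟩ := homFit_eventually (2 * p) q (2 * c + 3) hpq
  refine ⟨2 ^ max L₀ 100 + (2 * c + 2), fun m hm hmem => ?_⟩
  have hm' : 2 ^ max L₀ 100 ≤ m := le_trans (Nat.le_add_right _ _) hm
  have hmc : 2 * c + 2 ≤ m := le_trans (Nat.le_add_left _ _) hm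
  have h100 : 2 ^ 100 ≤ m := le_trans (Nat.pow_le_pow_right (by norm_num) (le_max_right _ _)) hm'
  have hm0 : m ≠ 0 := by omega
  have hL100 : 100 ≤ Nat.log 2 m := Nat.le_log_of_pow_le (by norm_num) h100
  have h2L : 2 ^ Nat.log 2 m ≤ m := Nat.pow_log_le_self 2 hm0
  -- the border circuit `D` (computing `h = IMM + O(ε)` with `≤ m^c + c` wires), pruned and set-multilinearised
  obtain ⟨h, ⟨D, hDh, hpd, hDs⟩, hord⟩ := hmem
  obtain ⟨D', hD'e, hD'd, hD'w, hD's⟩ := exists_size_le_edgeSize D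
  obtain ⟨H, hH, hhom, hHpd, hHsize, -⟩ :=
    exists_sml_circuit (Prod.fst : Fin (Nat.sqrt (Nat.log 2 m)) × Fin m × Fin m → Fin _) D'
  -- the set-multilinear projection fixes `IMM` and keeps `O(ε)` terms `O(ε)`
  have hproj : smlProj (Prod.fst : Fin (Nat.sqrt (Nat.log 2 m)) × Fin m × Fin m → Fin _) Finset.univ
      (MvPolynomial.map (algebraMap F (LaurentSeries F)) (immPoly m (Nat.sqrt (Nat.log 2 m)) F)) =
      MvPolynomial.map (algebraMap F (LaurentSeries F)) (immPoly m (Nat.sqrt (Nat.log 2 m)) F) := by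
    rw [map_immPoly]
    exact IsSetMultilinear.smlProj_eq _ (isSetMultilinear_immPoly (LaurentSeries F) m _)
  have hHc : PolyOrdGE 1 (H.eval -
      MvPolynomial.map (algebraMap F (LaurentSeries F)) (immPoly m (Nat.sqrt (Nat.log 2 m)) F)) := by
    rw [show H.eval = _ from hH, hD'e, show D.eval = h from hDh, ← hproj, ← map_sub]
    exact polyOrdGE_smlProj _ _ hord
  have hHpd' : H.productDepth ≤ 2 * p * Nat.log 2 (Nat.log 2 (Nat.log 2 m)) / q + (2 * c + 3) := by
    have h1 : 2 * (p * Nat.log 2 (Nat.log 2 (Nat.log 2 m)) / q) ≤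
        2 * p * Nat.log 2 (Nat.log 2 (Nat.log 2 m)) / q := by
      rw [mul_assoc]; exact Nat.mul_div_le_mul_div_assoc _ _ _
    calc H.productDepth ≤ 2 * D'.productDepth := hHpd
      _ ≤ 2 * D.productDepth := Nat.mul_le_mul_left 2 hD'd
      _ ≤ 2 * (p * Nat.log 2 (Nat.log 2 (Nat.log 2 m)) / q + c) := Nat.mul_le_mul_left 2 hpd
      _ = 2 * (p * Nat.log 2 (Nat.log 2 (Nat.log 2 m)) / q) + 2 * c := by rw [mul_add]
      _ ≤ _ := add_le_add h1 (by omega)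
  have hcore := homImmHard_coreK_border F (2 * p) q (2 * c + 3) hpq hL₀ m hm' rfl rfl H hhom hHc hHpd'
  -- the size bookkeeping, verbatim from `immHard_anyField`
  have hγ : gamma (Nat.sqrt (Nat.log 2 m)) ≤ m * m :=
    (gamma_le (Nat.log 2 m) _ rfl hL100).trans (Nat.mul_le_mul h2L h2L)
  have hDD : D'.edgeSize + D'.size ≤ 2 * (m ^ c + c) := by omega
  have hsz : H.size ≤ 2 * (m ^ c + c) * (m * m) := hHsize.trans (Nat.mul_le_mul hDD hγ)
  have hm1 : 1 ≤ m := by omega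
  have hmc1 : 1 ≤ m ^ c := Nat.one_le_pow _ _ hm1
  have e1 : c * (m * m) ≤ c * m ^ c * (m * m) := by
    have h1 : c * 1 ≤ c * m ^ c := Nat.mul_le_mul_left c hmc1
    rw [mul_one] at h1
    exact Nat.mul_le_mul_right _ h1
  have hfin : 2 * (m ^ c + c) * (m * m) ≤ m ^ (2 * c + 3) + (2 * c + 3) := by
    calc 2 * (m ^ c + c) * (m * m) = 2 * m ^ c * (m * m) + 2 * (c * (m * m)) := by ring
      _ ≤ 2 * m ^ c * (m * m) + 2 * (c * m ^ c * (m * m)) :=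
          Nat.add_le_add_left (Nat.mul_le_mul_left 2 e1) _
      _ = (2 + 2 * c) * m ^ c * (m * m) := by ring
      _ ≤ m * m ^ c * (m * m) := Nat.mul_le_mul_right _ (Nat.mul_le_mul_right _ (by omega))
      _ = m ^ (c + 3) := by ring
      _ ≤ m ^ (2 * c + 3) := Nat.pow_le_pow_right hm1 (by omega)
      _ ≤ _ := Nat.le_add_right _ _
  omega

/-- ★ **The same in circuit language**: for every field `F`, `2p < q` and `c`, for all large `m`, every
circuit `D` over `F((ε))` computing `IMM_{m,⌊√⌊log₂ m⌋⌋} + O(ε)` coefficientwise (`PolyOrdGE 1`) in product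
depth `≤ ⌊p·⌊log₂⌊log₂⌊log₂ m⌋⌋⌋/q⌋ + c` has more than `m^c + c` wires — literally the statement of
`immHard_anyField` with `D.Computes IMM` weakened to `D.eval = IMM + O(ε)`.
[cite: AndrewsForbes2022, Cor. 6.5] [cite: Forbes2024LowDepth, Thm. 1] [cite: LimayeSrinivasanTavenas2025, Cor. 4] -/
theorem immBorderHard_anyField_circuit (F : Type u) [Field F] {p q : ℕ} (hpq : 2 * p < q) (c : ℕ) :
    ∃ m₁ : ℕ, ∀ m : ℕ, m₁ ≤ m →
      ∀ D : ArithCircuit (LaurentSeries F) (Fin (Nat.sqrt (Nat.log 2 m)) × Fin m × Fin m),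
        PolyOrdGE 1 (D.eval -
          MvPolynomial.map (algebraMap F (LaurentSeries F)) (immPoly m (Nat.sqrt (Nat.log 2 m)) F)) →
        D.productDepth ≤ p * Nat.log 2 (Nat.log 2 (Nat.log 2 m)) / q + c → m ^ c + c < D.edgeSize := by
  obtain ⟨m₁, hm₁⟩ := immBorderHard_anyField F hpq c
  refine ⟨m₁, fun m hm D hD hpd => ?_⟩
  by_contra hle
  push Not at hle
  exact hm₁ m hm ⟨D.eval, ⟨D, rfl, hpd, hle⟩, hD⟩

end

end Summit.ValiantsHypothesis.ValiantsHypothesis.Theorems.VPBoundarySquare
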